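import Mathlib
import Summits.Ventures.PercRepro2.MixChordRelabel
import Summits.Ventures.PercRepro2.MixChordNarrowed

/-!
# The crux modulo (HALF-CHORD) on the `o`/`b`-coincidence root edges and (MIX-CHORD) on the root
edges with an unmarked far cluster (blind cell PercRepro2, night-1 g19; NIGHT1-G19.md §7)

With the sure relabelling (`MixChordRelabel.lean`) the root edges whose far end's weight-`1`
cluster carries `a₃` are closed (`A3Class`, `mixChord_of_a3Class`).  Hence
**`HCov_all_of_halfChord_of_unmarked`**: the crux from (HALF-CHORD) along the root edges whose far
cluster carries `o` or `b` and the mixed chord along the root edges whose far cluster carries none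
of `o`, `b`, `a₃` (`MixChordUnmarked_all`).

Own code; standard axioms.
-/

namespace Summit.Ventures.PercRepro2

open UnionCluster CovForm

namespace Mix

open scoped Classical

section Narrowed2

variable {V : Type*} {E : Type*} [Fintype E] [DecidableEq E] [Fintype V] [DecidableEq V]
  {R : Type*} [Field R] [LinearOrder R] [IsStrictOrderedRing R]

variable (p : E → R) (ends : E → Sym2 V) (a₁ a₂ a₃ : V) (e : E)

/-- A root edge whose far end carries `a₃` in its weight-`1` cluster. -/
def A3Class : Prop :=
  ∃ x y, ends e = s(x, y) ∧
    (x ∈ cluster ends (Chord.oneConfig p) a₁ ∨ x ∈ cluster ends (Chord.oneConfig p) a₂) ∧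
    a₃ ∈ cluster ends (Chord.oneConfig p) y

omit [Fintype E] [DecidableEq E] [Fintype V] [DecidableEq V] in
/-- Membership in a weight-`1` cluster is symmetric. -/
lemma mem_cluster_symm {ω : Config E} {u v : V} (h : u ∈ cluster ends ω v) : v ∈ cluster ends ω u :=
  mem_cluster.2 (conn_symm (mem_cluster.1 h))

/-- **(MIX-CHORD) along every root edge of the `a₃`-class** (sure relabelling + g18). -/
theorem mixChord_of_a3Class {p : E → R} {ends : E → Sym2 V} {o a₁ a₂ a₃ b : V} {e : E}
    (hp : IsProbVec p) (he : e ∈ Chord.rootEdges p ends a₁ a₂) (hc : A3Class p ends a₁ a₂ a₃ e) :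
    p e * Gc (Function.update p e 1) ends o a₁ a₂ a₃ b +
      (1 - p e) * (shrink p ends a₁ a₂ a₃ e * Gc (Function.update p e 0) ends o a₁ a₂ a₃ b) ≤
        Gc p ends o a₁ a₂ a₃ b := by
  obtain ⟨x, y, hxy, hx | hx, hy⟩ := hc
  · exact mixChord_a3Cluster_rootCluster p ends o b hp (Chord.frac_of_mem_rootEdges he)
      (mem_cluster_symm ends hy) hx (by rw [hxy, Sym2.eq_swap])
  · exact mixChord_a3Cluster_rootCluster₂ p ends o b hp (Chord.frac_of_mem_rootEdges he)
      (mem_cluster_symm ends hy) hx (by rw [hxy, Sym2.eq_swap])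

/-- **(MIX-CHORD) at `p` from the half-chord along the coincidence root edges and the mixed chord
along the root edges whose far end's weight-`1` cluster carries none of `o`, `b`, `a₃`.** -/
theorem mixChord_of_halfChord_of_unmarked {p : E → R} {ends : E → Sym2 V} {o a₁ a₂ a₃ b : V}
    (hp : IsProbVec p)
    (hhalf : ∀ e ∈ Chord.rootEdges p ends a₁ a₂, CoincidenceClass p ends o a₁ a₂ b e →
      HalfChord p ends o a₁ a₂ a₃ b e)
    (hrest : ∀ e ∈ Chord.rootEdges p ends a₁ a₂, ¬ ClosedClass p ends a₁ a₂ a₃ e →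
      ¬ CoincidenceClass p ends o a₁ a₂ b e → ¬ A3Class p ends a₁ a₂ a₃ e →
      p e * Gc (Function.update p e 1) ends o a₁ a₂ a₃ b +
        (1 - p e) * (shrink p ends a₁ a₂ a₃ e * Gc (Function.update p e 0) ends o a₁ a₂ a₃ b) ≤
          Gc p ends o a₁ a₂ a₃ b) :
    MixChord p ends o a₁ a₂ a₃ b := by
  refine mixChord_of_halfChord_of_rest hp hhalf fun e he hc hco => ?_
  by_cases h3 : A3Class p ends a₁ a₂ a₃ e
  · exact mixChord_of_a3Class hp he h3
  · exact hrest e he hc hco h3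

end Narrowed2

section Narrowed2All

variable (R : Type*) [Field R] [LinearOrder R] [IsStrictOrderedRing R]

/-- (MIX-CHORD) along every root edge whose far end's weight-`1` cluster carries none of `o`, `b`,
`a₃` (and which is neither internal nor a bridge), over all instances. -/
def MixChordUnmarked_all : Prop :=
  ∀ (V E : Type) [Fintype V] [DecidableEq V] [Fintype E] [DecidableEq E]
    (ends : E → Sym2 V) (p : E → R), IsProbVec p →
    ∀ o a₁ a₂ a₃ b : V, a₁ ≠ a₂ → a₁ ≠ a₃ → a₂ ≠ a₃ → o ≠ a₁ → o ≠ a₂ → o ≠ a₃ → o ≠ b →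
      b ≠ a₁ → b ≠ a₂ → b ≠ a₃ →
      ∀ e ∈ Chord.rootEdges p ends a₁ a₂, ¬ ClosedClass p ends a₁ a₂ a₃ e →
        ¬ CoincidenceClass p ends o a₁ a₂ b e → ¬ A3Class p ends a₁ a₂ a₃ e →
        p e * Gc (Function.update p e 1) ends o a₁ a₂ a₃ b +
          (1 - p e) * (shrink p ends a₁ a₂ a₃ e * Gc (Function.update p e 0) ends o a₁ a₂ a₃ b) ≤
            Gc p ends o a₁ a₂ a₃ b

/-- **The crux from (HALF-CHORD) on the `o`/`b`-coincidence root edges and (MIX-CHORD) on the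
root edges with an unmarked far cluster.** -/
theorem HCov_all_of_halfChord_of_unmarked (h₁ : HalfChordCoincidence_all R)
    (h₂ : MixChordUnmarked_all R) : HCov_all R :=
  HCov_all_of_mixChord_all R fun V E _ _ _ _ ends p hp o a₁ a₂ a₃ b h12 h13 h23 ho1 ho2 ho3 hob
    hb1 hb2 hb3 =>
      mixChord_of_halfChord_of_unmarked hp
        (h₁ V E ends p hp o a₁ a₂ a₃ b h12 h13 h23 ho1 ho2 ho3 hob hb1 hb2 hb3)
        (h₂ V E ends p hp o a₁ a₂ a₃ b h12 h13 h23 ho1 ho2 ho3 hob hb1 hb2 hb3)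

end Narrowed2All

end Mix

end Summit.Ventures.PercRepro2
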